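import Literature.AlgebraicGeometry.Motives.HodgeStructureOrientationOfGaloisDegree
import Literature.AlgebraicGeometry.Motives.MumfordTateRankOfOrientationUpperBound
import Mathlib.NumberTheory.Cyclotomic.Gal
import HarnessLib

/-!
# The cyclotomic field `ℚ(ζ₂₄)`: an effective `3`-orientation `Π` with `𝓡(Π) = 4 < 5 = 𝓡(Θ^G_Π)` — Green–Griffiths–Kerr's
# Question (V.A.10) fails for an actual oriented CM field, and `V³_{(ℚ(ζ₂₄),Π)}` is a degenerate irreducible SCMpHS of CY type

[topic AlgebraicGeometry/Motives]

Lane `lit-hodgefound` (seat `lit-hodgefound-p02`, gen 26, row g26-#8).  `HodgeStructureOrientationOfGaloisDegree.lean` §3 reads the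
group-level counterexample `CounterexampleVA10` (`OrientedTypeRankPrimeDegree.lean` §1) on any Galois CM field `L` with an
isomorphism `e : Gal(L/ℚ) ≃* G8 = (ℤ/2)³` carrying complex conjugation to `ρ8 = (1,0,0)`.  This file DISCHARGES that hypothesis
for `L = ℚ(ζ₂₄)` (`CyclotomicField 24 ℚ`): `Gal(ℚ(ζ₂₄)/ℚ) ≅ (ℤ/24)^×` (Mathlib's `IsCyclotomicExtension.autEquivPow`, `σ_t : ζ ↦ ζ^t`),
complex conjugation is `σ_{−1}` (`autEquivPow_conjGal`), and `(ℤ/24)^× ≅ (ℤ/2)³` by the three quadratic characters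
`t mod 4 = 3`, `t mod 8 ∈ {3,5}`, `[t mod 4 = 3] + [t mod 3 = 2]` (`unitsEquiv`, chosen so that `−1 ↦ (1,0,0)`;
`unitsEquiv_neg_one`).  Hence (`galEquiv`, `galEquiv_conjGal`) the UNCONDITIONAL statements: **`exists_orientation_kubotaRank_lt`**
— on `ℚ(ζ₂₄)` there are an effective `3`-orientation `Π` and its G-type `Θ` (`deg_Θ = [3 < 2 deg_Π]`, so `Θ ∈ Θ(Π)`) with
`𝓡(ℚ(ζ₂₄),Π) = 4 < 5 = 𝓡(ℚ(ζ₂₄),Θ)` ((V.A.10) p. 158 answered NO), **`exists_orientation_kubotaRank_lt_of_three_le`** (the same in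
EVERY weight `n ≥ 3`, `n ≠ 4`, from the family `a·p8 + k`) — and **`exists_degenerate_irreducible_weight_three`** —
`V³_{(ℚ(ζ₂₄),Π)}` has Hodge numbers `(1,3,3,1)`, is irreducible and degenerate (GGK's remark after (V.D.7) p. 165); §4, through
(V.D.5) of `MumfordTateRankOfOrientationUpperBound` (conditional on the tree's `HodgeTensorFacts` like that file):
**`exists_orientation_mtRank_lt`** (`dim M(V³) = 4`, `dim M(V¹_{Θ^G}) = 5`) and `exists_isIrreducible_mtRank_lt`.

HONEST SCOPE.  `IsGalois ℚ ℚ(ζ₂₄)` and `IsCMField ℚ(ζ₂₄)` are Mathlib THEOREMS, not instances (`IsCyclotomicExtension.isGalois`,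
`IsCyclotomicExtension.Rat.isCMField`, used through private lemmas); `galEquiv_conjGal` takes `[IsCMField K24]` as an instance
argument and the two final theorems discharge everything (no `instance` is declared).
`Π` in coordinates: `Π^{3,0} = {θ₁}`, `Π^{0,3} = {θ₂₃}`, `Π^{2,1} = {θ_t | unitsEquiv t ∈ {101,110,111}}`, the rest `Π^{1,2}`
(`θ_t : ζ₂₄ ↦ e^{2πit/24}` up to the base embedding `ι`).

## References
* [GreenGriffithsKerr2012] M. Green, P. Griffiths, M. Kerr, *Mumford–Tate Groups and Domains: Their Geometry and
  Arithmetic*, Ann. of Math. Stud. 183, Princeton UP (2012): (V.A.4) p. 156 («F abelian … F′ = F = F^c», `θ_i = θ₁σ_i`),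
  (V.A.10) p. 158, (V.D.7) p. 165.
-/

noncomputable section

open scoped Pointwise

open NumberField Module

namespace Literature.AlgebraicGeometry.Motives

namespace HodgeStructure

namespace Orientation

namespace CounterexampleVA10

open Literature.NumberTheory.ComplexMultiplication Literature.NumberTheory.ComplexMultiplication.CounterexampleVA10

/-! ## §1 `(ℤ/24)^× ≅ (ℤ/2)³` with `−1 ↦ ρ8` -/

/-- The three quadratic characters of `(ℤ/24)^×` packaged as a map `ℤ/24 → G8`: `t ↦ ([t ≡ 3 (4)], [t ≡ ±3 (8)],
[t ≡ 3 (4)] + [t ≡ 2 (3)])` (values on non-units irrelevant). [cite: GreenGriffithsKerr2012, (V.A.4) p. 156] -/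
def charMap (x : ZMod 24) : G8 :=
  el (if x.val % 4 = 3 then 1 else 0) (if x.val % 8 = 3 ∨ x.val % 8 = 5 then 1 else 0)
    ((if x.val % 4 = 3 then 1 else 0) + (if x.val % 3 = 2 then 1 else 0))

/-- Multiplicativity on units (a finite check). [folklore] -/
private theorem charMap_mul : ∀ x y : ZMod 24, Nat.Coprime x.val 24 → Nat.Coprime y.val 24 →
    charMap (x * y) = charMap x * charMap y := by
  decide

/-- Injectivity on units (a finite check). [folklore] -/
private theorem charMap_injOn : ∀ x y : ZMod 24, Nat.Coprime x.val 24 → Nat.Coprime y.val 24 →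
    charMap x = charMap y → x = y := by
  decide

/-- `charMap 1 = 1`. [folklore] -/
private theorem charMap_one : charMap 1 = 1 := by decide

/-- `charMap (−1) = ρ8 = (1,0,0)`. [folklore] -/
private theorem charMap_neg_one : charMap (-1) = ρ8 := by decide

/-- The character map on `(ℤ/24)^×` as a group homomorphism to `G8`. [cite: GreenGriffithsKerr2012, (V.A.4) p. 156] -/
def unitsHom : (ZMod 24)ˣ →* G8 where
  toFun u := charMap (u : ZMod 24)
  map_one' := by rw [Units.val_one, charMap_one]
  map_mul' u v := by
    rw [Units.val_mul]
    exact charMap_mul _ _ (ZMod.val_coe_unit_coprime u) (ZMod.val_coe_unit_coprime v)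

/-- Unfolding. [folklore] -/
private theorem unitsHom_apply (u : (ZMod 24)ˣ) : unitsHom u = charMap (u : ZMod 24) := rfl

/-- `unitsHom` is bijective (injective between sets of size `8 = φ(24)`). [cite: GreenGriffithsKerr2012, (V.A.4) p. 156] -/
theorem unitsHom_bijective : Function.Bijective unitsHom := by
  have hinj : Function.Injective unitsHom := fun u v huv =>
    Units.ext (charMap_injOn _ _ (ZMod.val_coe_unit_coprime u) (ZMod.val_coe_unit_coprime v) huv)
  refine (Fintype.bijective_iff_injective_and_card _).2 ⟨hinj, ?_⟩
  rw [ZMod.card_units_eq_totient, card_G8]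
  decide

/-- **`(ℤ/24)^× ≃* (ℤ/2)³`.** [cite: GreenGriffithsKerr2012, (V.A.4) p. 156] -/
def unitsEquiv : (ZMod 24)ˣ ≃* G8 := MulEquiv.ofBijective unitsHom unitsHom_bijective

/-- **`unitsEquiv (−1) = ρ8`.** [cite: GreenGriffithsKerr2012, (V.A.4) p. 156] -/
theorem unitsEquiv_neg_one : unitsEquiv (-1) = ρ8 := by
  rw [unitsEquiv, MulEquiv.ofBijective_apply, unitsHom_apply, Units.val_neg, Units.val_one]
  exact charMap_neg_one

/-! ## §2 `Gal(ℚ(ζ₂₄)/ℚ) ≃* (ℤ/2)³` with complex conjugation `↦ ρ8` -/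

/-- `ℚ(ζ₂₄)`. [cite: GreenGriffithsKerr2012, (V.A.4) p. 156] -/
abbrev K24 : Type := CyclotomicField 24 ℚ

/-- `Φ₂₄` is irreducible over `ℚ`. [folklore] -/
private theorem irreducible_cyclotomic24 : Irreducible (Polynomial.cyclotomic 24 ℚ) :=
  Polynomial.cyclotomic.irreducible_rat (by norm_num)

/-- `ℚ(ζ₂₄)` is the `24`-th cyclotomic extension of `ℚ` (Mathlib's instance is keyed on a variable `n`; we name the term).
[folklore] -/
private theorem isCyclotomicExtension_K24 : IsCyclotomicExtension {24} ℚ K24 := CyclotomicField.isCyclotomicExtension 24 ℚ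

/-- `ℚ(ζ₂₄)/ℚ` is Galois (Mathlib theorem, not an instance). [folklore] -/
private theorem isGalois_K24 : IsGalois ℚ K24 :=
  haveI := isCyclotomicExtension_K24
  IsCyclotomicExtension.isGalois {24} ℚ K24

/-- `ℚ(ζ₂₄)` is a CM field (Mathlib theorem, not an instance). [folklore] -/
private theorem isCMField_K24 : IsCMField K24 :=
  @IsCyclotomicExtension.Rat.isCMField K24 _ _ {24} ⟨24, Set.mem_singleton 24, by norm_num⟩ isCyclotomicExtension_K24

/-- **`Gal(ℚ(ζ₂₄)/ℚ) ≃* (ℤ/2)³`**: Mathlib's `σ ↦ t` (`σ ζ = ζ^t`) followed by `unitsEquiv`. [cite: GreenGriffithsKerr2012, (V.A.4) p. 156] -/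
def galEquiv : (K24 ≃ₐ[ℚ] K24) ≃* G8 :=
  haveI := isCyclotomicExtension_K24
  (IsCyclotomicExtension.autEquivPow K24 irreducible_cyclotomic24).trans unitsEquiv

/-- **Complex conjugation of `ℚ(ζ₂₄)` is `σ_{−1} : ζ ↦ ζ⁻¹`, so `galEquiv ρ = unitsEquiv (−1) = ρ8 = (1,0,0)`.**
[cite: GreenGriffithsKerr2012, (V.A.4) p. 156 («θ_j^{-1} = θ_{j⁻¹}»; ρ = σ_{−1})] -/
theorem galEquiv_conjGal [IsCMField K24] : galEquiv (conjGal : K24 ≃ₐ[ℚ] K24) = ρ8 := by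
  haveI := isCyclotomicExtension_K24
  have hζ := IsCyclotomicExtension.zeta_spec 24 ℚ K24
  obtain ⟨ι⟩ : Nonempty (K24 →+* ℂ) := inferInstance
  -- `ρ ζ = ζ⁻¹ = ζ²³`
  have hconj : (conjGal : K24 ≃ₐ[ℚ] K24) (IsCyclotomicExtension.zeta 24 ℚ K24) = (IsCyclotomicExtension.zeta 24 ℚ K24)⁻¹ := by
    apply ι.injective
    rw [conjGal_apply, IsCMField.complexEmbedding_complexConj, map_inv₀]
    have h1 : ‖ι (IsCyclotomicExtension.zeta 24 ℚ K24)‖ = 1 := by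
      have h24 : (ι (IsCyclotomicExtension.zeta 24 ℚ K24)) ^ 24 = 1 := by rw [← map_pow, hζ.pow_eq_one, map_one]
      exact Complex.norm_eq_one_of_pow_eq_one h24 (by norm_num)
    exact (Complex.inv_eq_conj h1).symm
  have hinv : (IsCyclotomicExtension.zeta 24 ℚ K24)⁻¹ = IsCyclotomicExtension.zeta 24 ℚ K24 ^ 23 := by
    have h : IsCyclotomicExtension.zeta 24 ℚ K24 ^ 23 * IsCyclotomicExtension.zeta 24 ℚ K24 = 1 := by
      rw [← pow_succ, hζ.pow_eq_one]
    exact (eq_inv_of_mul_eq_one_left h).symm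
  -- the exponent of `ρ` is `23 = −1`
  have key : IsCyclotomicExtension.autEquivPow K24 irreducible_cyclotomic24 (conjGal : K24 ≃ₐ[ℚ] K24) = -1 := by
    have hspec := hζ.autToPow_spec ℚ (conjGal : K24 ≃ₐ[ℚ] K24)
    rw [hconj, hinv] at hspec
    have hval : ((hζ.autToPow ℚ (conjGal : K24 ≃ₐ[ℚ] K24) : (ZMod 24)ˣ) : ZMod 24).val = 23 :=
      hζ.pow_inj (ZMod.val_lt _) (by norm_num) hspec
    have htz : ((hζ.autToPow ℚ (conjGal : K24 ≃ₐ[ℚ] K24) : (ZMod 24)ˣ) : ZMod 24) = ((-1 : (ZMod 24)ˣ) : ZMod 24) := by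
      apply ZMod.val_injective
      rw [hval, Units.val_neg, Units.val_one]
      decide
    rw [IsCyclotomicExtension.autEquivPow_apply]
    exact Units.ext htz
  show ((IsCyclotomicExtension.autEquivPow K24 irreducible_cyclotomic24).trans unitsEquiv) conjGal = ρ8
  rw [MulEquiv.trans_apply, key, unitsEquiv_neg_one]

/-! ## §3 The unconditional statements on `ℚ(ζ₂₄)` -/

/-- **QUESTION (V.A.10) FAILS ON `ℚ(ζ₂₄)`**: there are an effective `3`-orientation `Π` of `ℚ(ζ₂₄)` and a type `Θ` refined by
`Π` (its G-type: `deg_Θ = [3 < 2·deg_Π]`) with `𝓡(ℚ(ζ₂₄),Π) = 4 < 5 = 𝓡(ℚ(ζ₂₄),Θ)`. [cite: GreenGriffithsKerr2012, (V.A.10) p. 158] -/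
theorem exists_orientation_kubotaRank_lt (ι : K24 →+* ℂ) :
    ∃ (Λ : Orientation K24 3) (Θ : Orientation K24 1),
      (∀ θ, 0 ≤ Λ.deg θ ∧ Λ.deg θ ≤ 3) ∧ (∀ θ, Θ.deg θ = if 3 < 2 * Λ.deg θ then 1 else 0) ∧
        Λ.kubotaRank (AlgHom.id ℚ K24) ι = 4 ∧ Θ.kubotaRank (AlgHom.id ℚ K24) ι = 5 ∧
          Λ.kubotaRank (AlgHom.id ℚ K24) ι < Θ.kubotaRank (AlgHom.id ℚ K24) ι := by
  haveI := isGalois_K24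
  haveI := isCMField_K24
  exact ⟨orientationPi ι galEquiv galEquiv_conjGal, orientationTheta ι galEquiv galEquiv_conjGal,
    orientationPi_effective ι galEquiv galEquiv_conjGal, orientationTheta_deg ι galEquiv galEquiv_conjGal,
    kubotaRank_orientationPi ι galEquiv galEquiv_conjGal, kubotaRank_orientationTheta ι galEquiv galEquiv_conjGal,
    kubotaRank_orientationPi_lt ι galEquiv galEquiv_conjGal⟩

/-- **A DEGENERATE IRREDUCIBLE WEIGHT-`3` SCMpHS OF CY TYPE: `V³_{(ℚ(ζ₂₄),Π)}`** — Hodge numbers `(1,3,3,1)`, irreducible,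
`𝓡 = 4 ≠ 5 = ½[F″:ℚ] + 1`. [cite: GreenGriffithsKerr2012, (V.D.7) p. 165] -/
theorem exists_degenerate_irreducible_weight_three (ι : K24 →+* ℂ) :
    ∃ Λ : Orientation K24 3,
      (ofOrientation Λ).hodgeNumber 3 (3 - 3) = 1 ∧ (ofOrientation Λ).hodgeNumber 2 (3 - 2) = 3 ∧
        (ofOrientation Λ).hodgeNumber 1 (3 - 1) = 3 ∧ (ofOrientation Λ).hodgeNumber 0 (3 - 0) = 1 ∧
          (ofOrientation Λ).IsIrreducible ∧ ¬Λ.IsNondegenerate (AlgHom.id ℚ K24) ι ∧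
            Λ.kubotaRank (AlgHom.id ℚ K24) ι = 4 := by
  haveI := isGalois_K24
  haveI := isCMField_K24
  exact ⟨orientationPi ι galEquiv galEquiv_conjGal, hodgeNumber_three_zero ι galEquiv galEquiv_conjGal,
    hodgeNumber_two_one ι galEquiv galEquiv_conjGal, hodgeNumber_one_two ι galEquiv galEquiv_conjGal,
    hodgeNumber_zero_three ι galEquiv galEquiv_conjGal, isIrreducible_ofOrientation_orientationPi ι galEquiv galEquiv_conjGal,
    not_isNondegenerate_orientationPi ι galEquiv galEquiv_conjGal, kubotaRank_orientationPi ι galEquiv galEquiv_conjGal⟩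

/-- **(V.A.10) FAILS ON `ℚ(ζ₂₄)` IN EVERY WEIGHT `n ≥ 3`, `n ≠ 4`**: an effective `n`-orientation `Λ` of `ℚ(ζ₂₄)` outside the pure
type and its G-type `Θ` (`deg_Θ = [n < 2·deg_Λ]`, `Θ ∈ Θ(Λ)`) with `𝓡(ℚ(ζ₂₄),Λ) = 4 < 5 = 𝓡(ℚ(ζ₂₄),Θ)` (group level:
`CounterexampleVA10.exists_degRank_lt_degRank_gType`, the family `a·p8 + k`). [cite: GreenGriffithsKerr2012, (V.A.10) p. 158] -/
theorem exists_orientation_kubotaRank_lt_of_three_le {n : ℤ} (hn : 3 ≤ n) (h4 : n ≠ 4) (ι : K24 →+* ℂ) :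
    ∃ (Λ : Orientation K24 n) (Θ : Orientation K24 1),
      (∀ θ, 0 ≤ Λ.deg θ ∧ Λ.deg θ ≤ n) ∧ (∀ θ, 2 * Λ.deg θ ≠ n) ∧ (∀ θ, Θ.deg θ = if n < 2 * Λ.deg θ then 1 else 0) ∧
        Λ.kubotaRank (AlgHom.id ℚ K24) ι = 4 ∧ Θ.kubotaRank (AlgHom.id ℚ K24) ι = 5 ∧
          Λ.kubotaRank (AlgHom.id ℚ K24) ι < Θ.kubotaRank (AlgHom.id ℚ K24) ι := by
  haveI := isGalois_K24
  haveI := isCMField_K24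
  obtain ⟨p, hp, heff, hnp, h4', h5, -⟩ := exists_degRank_lt_degRank_gType hn h4
  have hpρ : ∀ g : K24 ≃ₐ[ℚ] K24, (p ∘ galEquiv) ((conjGal : K24 ≃ₐ[ℚ] K24) * g) = n - (p ∘ galEquiv) g := by
    intro g
    simp only [Function.comp_apply, map_mul, galEquiv_conjGal]
    exact hp.deg_rho (galEquiv g)
  have htρ : ∀ g : K24 ≃ₐ[ℚ] K24, ((fun x => if n < 2 * p x then (1 : ℤ) else 0) ∘ galEquiv) ((conjGal : K24 ≃ₐ[ℚ] K24) * g) =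
      1 - ((fun x => if n < 2 * p x then (1 : ℤ) else 0) ∘ galEquiv) g := by
    intro g
    simp only [Function.comp_apply, map_mul, galEquiv_conjGal]
    have h1 : p (ρ8 * galEquiv g) = n - p (galEquiv g) := hp.deg_rho (galEquiv g)
    have h2 := hnp (galEquiv g)
    rw [h1]
    by_cases h : n < 2 * p (galEquiv g)
    · rw [if_pos h, if_neg (by omega)]
      norm_num
    · rw [if_neg h, if_pos (by omega)]
      norm_num
  refine ⟨ofGaloisDeg ι (p ∘ galEquiv) hpρ, ofGaloisDeg ι ((fun x => if n < 2 * p x then (1 : ℤ) else 0) ∘ galEquiv) htρ,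
    fun θ => heff _, fun θ => hnp _, fun θ => rfl, ?_, ?_, ?_⟩
  · rw [kubotaRank_ofGaloisDeg, degRank_comp_mulEquiv, h4']
  · rw [kubotaRank_ofGaloisDeg, degRank_comp_mulEquiv, h5]
  · rw [kubotaRank_ofGaloisDeg, kubotaRank_ofGaloisDeg, degRank_comp_mulEquiv, degRank_comp_mulEquiv, h4', h5]
    norm_num

/-! ## §4 Mumford–Tate dimensions: `dim M_φ̃(V³_{(ℚ(ζ₂₄),Π)}) = 4 < 5 = dim M(V¹_{(ℚ(ζ₂₄),Θ^G_Π)})` -/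

/-- **Through (V.D.5) (`mtRank_ofOrientation_eq_kubotaRank`, g26-#1): the Mumford–Tate group of `V³_{(ℚ(ζ₂₄),Π)}` has dimension
`4`, that of the G-JACOBIAN `V¹_{(ℚ(ζ₂₄),Θ^G_Π)}` has dimension `5`** — the refined type's Hodge structure has the LARGER Mumford–Tate
group (compare (V.D.8), where GGK record the opposite behaviour on `ℚ(ζ₃₂)`).  Conditional on the tree's standing tensor facts
`HodgeTensorFacts`, as all of `MumfordTateRankOfOrientationUpperBound`. [cite: GreenGriffithsKerr2012, (V.D.5) p. 164 and (V.D.7)–(V.D.8) pp. 165–166] -/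
theorem exists_orientation_mtRank_lt [HodgeTensorFacts.{0, 0}] :
    ∃ (Λ : Orientation K24 3) (Θ : Orientation K24 1),
      (∀ θ, 0 ≤ Λ.deg θ ∧ Λ.deg θ ≤ 3) ∧ (∀ θ, Θ.deg θ = if 3 < 2 * Λ.deg θ then 1 else 0) ∧
        (ofOrientation Λ).mtRank = 4 ∧ (ofOrientation Θ).mtRank = 5 := by
  haveI := isGalois_K24
  haveI := isCMField_K24
  obtain ⟨ι⟩ : Nonempty (K24 →+* ℂ) := inferInstance
  refine ⟨orientationPi ι galEquiv galEquiv_conjGal, orientationTheta ι galEquiv galEquiv_conjGal,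
    orientationPi_effective ι galEquiv galEquiv_conjGal, orientationTheta_deg ι galEquiv galEquiv_conjGal, ?_, ?_⟩
  · rw [mtRank_ofOrientation_eq_kubotaRank _ (AlgHom.id ℚ K24) ι, kubotaRank_orientationPi]
  · rw [mtRank_ofOrientation_eq_kubotaRank _ (AlgHom.id ℚ K24) ι, kubotaRank_orientationTheta]

/-- **`dim M_φ̃(V³_{(ℚ(ζ₂₄),Π)}) = 4 < ½·8 + 1`: a CY-type weight-`3` CM Hodge structure of rank `8` whose Mumford–Tate group is NOT
as large as possible although the Hodge structure is irreducible.** [cite: GreenGriffithsKerr2012, (V.D.5) p. 164 and (V.D.7) p. 165] -/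
theorem exists_isIrreducible_mtRank_lt [HodgeTensorFacts.{0, 0}] :
    ∃ Λ : Orientation K24 3, (ofOrientation Λ).IsIrreducible ∧ (ofOrientation Λ).hodgeNumber 3 (3 - 3) = 1 ∧
      (ofOrientation Λ).mtRank = 4 ∧ (ofOrientation Λ).mtRank < Module.finrank ℚ K24 / 2 + 1 := by
  haveI := isGalois_K24
  haveI := isCMField_K24
  obtain ⟨ι⟩ : Nonempty (K24 →+* ℂ) := inferInstance
  have h4 : (ofOrientation (orientationPi ι galEquiv galEquiv_conjGal)).mtRank = 4 := by
    rw [mtRank_ofOrientation_eq_kubotaRank _ (AlgHom.id ℚ K24) ι, kubotaRank_orientationPi]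
  refine ⟨orientationPi ι galEquiv galEquiv_conjGal, isIrreducible_ofOrientation_orientationPi ι galEquiv galEquiv_conjGal,
    hodgeNumber_three_zero ι galEquiv galEquiv_conjGal, h4, ?_⟩
  rw [h4, finrank_eq_eight galEquiv]
  norm_num

end CounterexampleVA10

end Orientation

end HodgeStructure

end Literature.AlgebraicGeometry.Motives
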